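import Summits.AtomisticToContinuum.Crystallization.Theorems.PalmUnimodularRigidityMinimiserShellsResidual
import Summits.AtomisticToContinuum.Crystallization.Theorems.MinimiserShells.Negative.UniformRooting
import Summits.AtomisticToContinuum.Crystallization.Theorems.MinimiserShells.Negative.PricingCeiling

/-!
# Linear pricing certificates contain the residual shell gap (crux `MinimiserShells`, stmt-AtomisticToContinuum-9225)

Route `PalmUnimodularRigidity`, crux decl
`Summit.AtomisticToContinuum.Crystallization.Theses.PalmUnimodularRigidity.MinimiserShells`, lead `…-c9-0`.

The crux-ideation vocabulary for this crux is a LINEAR PRICING certificate: an expectation inequality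
`e* + c · P(root shell fails G) ≤ E_P[h]` over all point-stationary hard-core probability laws `P`, for some shell
predicate `G` and constant `c > 0` (Disproof §5 `LinearPricing`; line `coarse-holonomy-liouville`'s hardest stub
`stub_coarsePricing` is the instance `G =` "(a/20)-good shell"; the cards cluster-defect-pricing,
defect-exchange-two-resolutions, link-euler-six-ring-tax, octahedral-annulus-mandate all aim at such rows).

This file proves, sorry-free, that every such certificate for a LOCAL predicate `G` (one that reads only the atoms of
the closed ball `B̄(0, 5/4)`) is already a PERIODIC CRYSTALLIZATION THEOREM for `G` with a linear constant: every
periodic configuration `Q` of `ℝ³` with `1/3`-separated points and at least `t · #motif` motif sites failing `G` has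
`e(Q) ≥ e* + c · t` (`le_energyPerParticle_of_pricing`).  The proof feeds the certificate with the uniformly rooted
laws of the `K³`-blocks of `Q` (`NecessityBlocks.exists_blocks`: finite, injective, `1/3`-separated, energy
`≤ N·(e(Q) + ε)`, bad fraction `≥ t − ε`; `Negative.UniformRooting`: such laws are exactly point-stationary, a.s.
`1/3`-hard-core, with `E_P[h] = 𝓔_N/N`), bounds the outer measure of the bad event from below by the bad fraction
(`natCard_le_mul_unifRooted_apply`, Dirac masses from below), and lets `ε → 0`.

Consequences (all by instantiation):
* `shellGap_of_loosePricing`: pricing the `θ`-loosely-bad shell (`Residual.LooseGoodShell θ`, `θ ≥ 0`) gives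
  `Residual.ShellGap θ` with `κ = c·t`;
* `shellGap_zero_of_linearPricing`: Disproof §5's fine certificate `LinearPricing c`, `c > 0`, gives the line's open
  residual `Residual.ShellGap 0` (hence the crux, `minimiserShells_of_linearPricing`, recovering §5's sufficiency
  through the residual);
* `shellGap_of_coarsePricing`: the hardest stub `stub_coarsePricing` of line `coarse-holonomy-liouville` (with that
  skeleton's local abbreviations `eStar` / `meanRootEnergy` / `GoodShell 20` unfolded) gives the COARSE periodic shell
  gap (`le_energyPerParticle_of_coarsePricing`) and `Residual.ShellGap (1/25)` — an `(a/20)`-good shell is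
  `(1/25)`-loosely good (`looseGoodShell_of_coarseGood`).

So every pricing line on this crux contains a `θ`-loosened hard-core periodic shell gap for three-dimensional
Lennard-Jones — the statement the crux is sandwiched against (`Residual.minimiserShells_sandwich`), i.e. bulk energetic
crystallization of LJ in first-shell form (Blanc–Lewin 2015 §2.3: open).  Nothing here is a published fact; these are
elementary consequences of files already in `Theorems/`.
-/

noncomputable section

open MeasureTheory
open scoped ENNReal BigOperators Classical

namespace Summit.AtomisticToContinuum.Crystallization.Theorems.PalmUnimodularRigidityMinimiserShells.PricingContainment

open Literature.Probability.Process (IsRootedHardCore IsPointStationaryLaw)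
open Literature.MathematicalPhysics.StatisticalMechanics (lennardJones interactionEnergy PeriodicConfiguration)
open Literature.Geometry.DiscreteGeometry (ShellCloseTo fccKissingPattern hcpKissingPattern
  norm_eq_one_of_mem_fccKissingPattern norm_eq_one_of_mem_hcpKissingPattern)
open Summit.AtomisticToContinuum.Crystallization.Theses.PalmUnimodularRigidity (MinimiserShells)
open Summit.AtomisticToContinuum.Crystallization.Theorems.MinimiserShells.Negative.LoadBearing
  (eStar meanRootEnergy GoodShell)
open Summit.AtomisticToContinuum.Crystallization.Theorems.MinimiserShells.Negative.UniformRooting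
  (rootedMeasure unifRooted rootedMeasure_eq_range isProbabilityMeasure_unifRooted
   isPointStationaryLaw_unifRooted ae_isRootedHardCore_unifRooted meanRootEnergy_unifRooted)
open Summit.AtomisticToContinuum.Crystallization.Theorems.MinimiserShells.Negative.PricingCeiling (LinearPricing)
open Summit.AtomisticToContinuum.Crystallization.Theorems.PalmUnimodularRigidityMinimiserShells.Residual
  (LooseGoodShell ShellGap IsSepThird looseBadMotifCount rerooted looseGoodShell_zero_iff
   minimiserShells_of_shellGap_zero norm_le_of_shellCloseTo shellCloseTo_mono)

open Summit.AtomisticToContinuum.Crystallization.Theorems.MinimiserShells.Negative.Rootedness (E3)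

/-! ## The bad event under a uniformly rooted law -/

/-- **Dirac masses from below.**  Under the uniformly rooted law `P_y = (1/N) Σ_i δ_{count|(y − y_i)}` the outer
measure of ANY set `B` of configurations is at least the fraction of indices `i` whose rooted configuration lies in
`B`: `#{i | count|(y − y_i) ∈ B} ≤ N · P_y(B)` (no measurability of `B` is needed: `1_B(a) ≤ δ_a(B)`). -/
theorem natCard_le_mul_unifRooted_apply {N : ℕ} [NeZero N] (y : Fin N → E3) (B : Set (Measure E3)) :
    (Nat.card {i : Fin N // rootedMeasure y i ∈ B} : ℝ) ≤ (N : ℝ) * ((unifRooted y) B).toReal := by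
  classical
  -- the sum of the Dirac masses of `B` dominates the number of indices in `B`
  have hsum : ((Nat.card {i : Fin N // rootedMeasure y i ∈ B} : ℕ) : ℝ≥0∞) ≤
      ∑ i : Fin N, (Measure.dirac (rootedMeasure y i) : Measure (Measure E3)) B := by
    have hind : ∑ i : Fin N, B.indicator (1 : Measure E3 → ℝ≥0∞) (rootedMeasure y i) ≤
        ∑ i : Fin N, (Measure.dirac (rootedMeasure y i) : Measure (Measure E3)) B :=
      Finset.sum_le_sum fun i _ => Measure.le_dirac_apply
    have hcard : ∑ i : Fin N, B.indicator (1 : Measure E3 → ℝ≥0∞) (rootedMeasure y i) =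
        ((Nat.card {i : Fin N // rootedMeasure y i ∈ B} : ℕ) : ℝ≥0∞) := by
      rw [Nat.card_eq_fintype_card, Fintype.card_subtype, Finset.card_eq_sum_ones, Nat.cast_sum,
        Finset.sum_filter]
      refine Finset.sum_congr rfl fun i _ => ?_
      by_cases hi : rootedMeasure y i ∈ B
      · simp [hi]
      · simp [hi]
    rw [← hcard]
    exact hind
  -- `P_y(B) = N⁻¹ · Σ_i δ_i(B)`
  have happly : (unifRooted y) B =
      (N : ℝ≥0∞)⁻¹ * ∑ i : Fin N, (Measure.dirac (rootedMeasure y i) : Measure (Measure E3)) B := by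
    simp only [unifRooted, Measure.smul_apply, Measure.coe_finsetSum, Finset.sum_apply, smul_eq_mul]
  have hN0 : (N : ℝ≥0∞) ≠ 0 := by exact_mod_cast (NeZero.ne N)
  have hNtop : (N : ℝ≥0∞) ≠ ∞ := ENNReal.natCast_ne_top N
  have hmul : (N : ℝ≥0∞) * (unifRooted y) B =
      ∑ i : Fin N, (Measure.dirac (rootedMeasure y i) : Measure (Measure E3)) B := by
    rw [happly, ← mul_assoc, ENNReal.mul_inv_cancel hN0 hNtop, one_mul]
  have hle : ((Nat.card {i : Fin N // rootedMeasure y i ∈ B} : ℕ) : ℝ≥0∞) ≤ (N : ℝ≥0∞) * (unifRooted y) B := by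
    rw [hmul]; exact hsum
  -- pass to real numbers (`P_y(B) ≤ 1 < ∞`)
  haveI : IsProbabilityMeasure (unifRooted y) := isProbabilityMeasure_unifRooted y
  have hfin : (N : ℝ≥0∞) * (unifRooted y) B ≠ ∞ := ENNReal.mul_ne_top hNtop (measure_ne_top _ _)
  have := ENNReal.toReal_mono hfin hle
  rw [ENNReal.toReal_natCast, ENNReal.toReal_mul, ENNReal.toReal_natCast] at this
  exact this

/-! ## The containment theorem -/

/-- **Linear pricing of a local shell predicate is a periodic crystallization theorem for it.**  Let `G` be a LOCAL
predicate of measures on `ℝ³` (two measures with the same atoms in `B̄(0, 5/4)` get the same verdict) and suppose the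
certificate `e* + c · P{μ | ¬ G μ} ≤ E_P[h]` holds for every point-stationary, almost surely `1/3`-hard-core
probability law `P`, with `c > 0`.  Then every periodic configuration `Q` of `ℝ³` with `1/3`-separated points in which
at least `t · #motif` motif sites `x` fail `G` (read in `Q.points` re-rooted at `x`) has `e* + c · t ≤ e(Q)`.
Proof: apply the certificate to the uniformly rooted law of a `K³`-block of `Q` (`NecessityBlocks.exists_blocks`,
`Negative.UniformRooting`), whose energy is `≤ e(Q) + ε` per particle and whose bad fraction is `≥ t − ε`
(`natCard_le_mul_unifRooted_apply`), and let `ε → 0`. -/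
theorem le_energyPerParticle_of_pricing {G : Measure E3 → Prop}
    (hloc : ∀ {μ ν : Measure E3}, (∀ w : E3, ‖w‖ ≤ 5 / 4 → (μ {w} ≠ 0 ↔ ν {w} ≠ 0)) → (G μ ↔ G ν))
    {c : ℝ} (hc : 0 < c)
    (hprice : ∀ P : Measure (Measure E3), IsProbabilityMeasure P →
      (∀ᵐ μ ∂P, IsRootedHardCore (1 / 3) μ) → IsPointStationaryLaw P →
      eStar + c * (P {μ | ¬ G μ}).toReal ≤ meanRootEnergy P)
    (Q : PeriodicConfiguration 3) (hsep : ∀ p ∈ Q.points, ∀ q ∈ Q.points, p ≠ q → (1 : ℝ) / 3 ≤ dist p q)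
    {t : ℝ}
    (hbad : t * (Q.motif.card : ℝ) ≤ (Nat.card {x : Q.motif //
      ¬ G ((Measure.count : Measure E3).restrict ((fun z => z - (x : E3)) '' Q.points))} : ℝ)) :
    eStar + c * t ≤ Q.energyPerParticle lennardJones := by
  -- it suffices to prove `e* + c·t ≤ e(Q) + ε'` for every `ε' > 0`
  refine le_of_forall_pos_le_add fun ε' hε' => ?_
  have hc1 : 0 < c + 1 := by linarith
  set ε : ℝ := ε' / (c + 1) with hεdef
  have hε : 0 < ε := div_pos hε' hc1
  have hεε' : (c + 1) * ε = ε' := by rw [hεdef]; field_simp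
  -- a block of `Q` with slack `ε`
  obtain ⟨N, hN, y, hy, hysep, hE, hcnt⟩ := NecessityBlocks.exists_blocks hloc Q hsep t hbad hε
  haveI : NeZero N := ⟨hN.ne'⟩
  have hNr : (0 : ℝ) < N := by exact_mod_cast hN
  -- its uniformly rooted law is an admissible test law of the certificate
  have hP : IsProbabilityMeasure (unifRooted y) := isProbabilityMeasure_unifRooted y
  have hcore : ∀ᵐ μ ∂(unifRooted y), IsRootedHardCore (1 / 3) μ := ae_isRootedHardCore_unifRooted hysep
  have hstat : IsPointStationaryLaw (unifRooted y) := isPointStationaryLaw_unifRooted hy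
  have hineq := hprice _ hP hcore hstat
  rw [meanRootEnergy_unifRooted hy] at hineq
  -- energy side: `𝓔_N(y)/N ≤ e(Q) + ε`
  have hEN : interactionEnergy lennardJones y / N ≤ Q.energyPerParticle lennardJones + ε := by
    rw [div_le_iff₀ hNr]
    linarith [hE]
  -- event side: `t − ε ≤ P{¬ G}`
  have hbadP : t - ε ≤ ((unifRooted y) {μ | ¬ G μ}).toReal := by
    have h1 := natCard_le_mul_unifRooted_apply y {μ | ¬ G μ}
    have h2 : Nat.card {i : Fin N //
          ¬ G ((Measure.count : Measure E3).restrict ((fun z => z - y i) '' Set.range y))} =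
        Nat.card {i : Fin N // rootedMeasure y i ∈ {μ | ¬ G μ}} := by
      refine Nat.card_congr (Equiv.subtypeEquivRight fun i => ?_)
      have hset : (fun z => z - y i) '' Set.range y = Set.range fun k => y k - y i := by
        ext w
        simp only [Set.mem_image, Set.mem_range, exists_exists_eq_and]
      rw [Set.mem_setOf_eq, rootedMeasure_eq_range, hset]
    rw [h2] at hcnt
    have h3 : (t - ε) * (N : ℝ) ≤ (N : ℝ) * ((unifRooted y) {μ | ¬ G μ}).toReal := hcnt.trans h1
    rw [mul_comm] at h3
    exact le_of_mul_le_mul_left h3 hNr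
  -- combine
  have h4 : eStar + c * (t - ε) ≤ Q.energyPerParticle lennardJones + ε := by
    have := mul_le_mul_of_nonneg_left hbadP hc.le
    linarith
  calc eStar + c * t = (eStar + c * (t - ε)) + c * ε := by ring
    _ ≤ (Q.energyPerParticle lennardJones + ε) + c * ε := by linarith
    _ = Q.energyPerParticle lennardJones + (c + 1) * ε := by ring
    _ = Q.energyPerParticle lennardJones + ε' := by rw [hεε']

/-! ## The loosened shell predicate: pricing it gives `Residual.ShellGap θ` -/

/-- The `θ`-loosened good-shell predicate is LOCAL for `θ ≥ 0` (it reads only atoms of norm `≤ (5/4 − θ)·a ≤ 5/4`;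
`NecessityBlocks.looseGood_congr_of_local`). -/
theorem looseGoodShell_congr_of_local {θ : ℝ} (hθ : 0 ≤ θ) {μ ν : Measure E3}
    (h : ∀ w : E3, ‖w‖ ≤ 5 / 4 → (μ {w} ≠ 0 ↔ ν {w} ≠ 0)) :
    LooseGoodShell θ μ ↔ LooseGoodShell θ ν :=
  NecessityBlocks.looseGood_congr_of_local hθ h

/-- **Pricing the `θ`-loosely-bad shell gives `ShellGap θ` (with the linear constant `κ = c·t`).**  If for some
`c > 0` every point-stationary, a.s. `1/3`-hard-core probability law satisfies
`e* + c · P{μ | ¬ LooseGoodShell θ μ} ≤ E_P[h]`, then `Residual.ShellGap θ` holds (`θ ≥ 0`). -/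
theorem shellGap_of_loosePricing {θ : ℝ} (hθ : 0 ≤ θ) {c : ℝ} (hc : 0 < c)
    (hprice : ∀ P : Measure (Measure E3), IsProbabilityMeasure P →
      (∀ᵐ μ ∂P, IsRootedHardCore (1 / 3) μ) → IsPointStationaryLaw P →
      eStar + c * (P {μ | ¬ LooseGoodShell θ μ}).toReal ≤ meanRootEnergy P) :
    ShellGap θ := by
  intro t ht
  refine ⟨c * t, mul_pos hc ht, fun Q hsep hbad => ?_⟩
  exact le_energyPerParticle_of_pricing (G := LooseGoodShell θ)
    (fun h => looseGoodShell_congr_of_local hθ h) hc hprice Q hsep hbad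

/-- **Disproof §5's fine certificate contains the residual**: `LinearPricing c` with `c > 0` (pricing of the crux's
own bad-shell event `¬ GoodShell`, for every hard core `δ > 0`) implies `Residual.ShellGap 0`, the open residual stub
S7⁗ of line `equilibrium-in-law-surgery`. -/
theorem shellGap_zero_of_linearPricing {c : ℝ} (hc : 0 < c) (h : LinearPricing c) : ShellGap 0 := by
  refine shellGap_of_loosePricing le_rfl hc fun P hP hcore hstat => ?_
  have hineq := h (1 / 3) (by norm_num) P hP hcore hstat
  simpa only [looseGoodShell_zero_iff] using hineq

/-- Hence (through the residual, `Residual.minimiserShells_of_shellGap_zero`) the fine certificate proves the crux —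
Disproof §5's `minimiserShells_of_linearPricing`, now factored through `ShellGap 0`. -/
theorem minimiserShells_of_linearPricing {c : ℝ} (hc : 0 < c) (h : LinearPricing c) : MinimiserShells :=
  minimiserShells_of_shellGap_zero (shellGap_zero_of_linearPricing hc h)

/-! ## The coarse shell predicate of line `coarse-holonomy-liouville` -/

/-- The COARSE good-shell predicate (`GoodShell 20` of skeleton `Lines/coarse-holonomy-liouville.lean`, unfolded: the
crux's shell test with matching tolerance `a/20` in place of `a/100`) is LOCAL: it reads only atoms of norm
`≤ 5a/4 ≤ 5/4`. -/
theorem coarseGood_congr_of_local {μ ν : Measure E3}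
    (h : ∀ w : E3, ‖w‖ ≤ 5 / 4 → (μ {w} ≠ 0 ↔ ν {w} ≠ 0)) :
    (∃ a : ℝ, 9 / 10 ≤ a ∧ a ≤ 1 ∧ ∃ T : Finset E3,
      (↑T : Set E3) = {y : E3 | μ {y} ≠ 0 ∧ y ≠ 0 ∧ ‖y‖ ≤ 5 / 4 * a} ∧
      (ShellCloseTo (a / 20) T (Finset.image (fun v : E3 => a • v) fccKissingPattern) ∨
        ShellCloseTo (a / 20) T (Finset.image (fun v : E3 => a • v) hcpKissingPattern))) ↔
    (∃ a : ℝ, 9 / 10 ≤ a ∧ a ≤ 1 ∧ ∃ T : Finset E3,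
      (↑T : Set E3) = {y : E3 | ν {y} ≠ 0 ∧ y ≠ 0 ∧ ‖y‖ ≤ 5 / 4 * a} ∧
      (ShellCloseTo (a / 20) T (Finset.image (fun v : E3 => a • v) fccKissingPattern) ∨
        ShellCloseTo (a / 20) T (Finset.image (fun v : E3 => a • v) hcpKissingPattern))) := by
  -- one direction suffices by symmetry of the hypothesis
  suffices key : ∀ {μ ν : Measure E3}, (∀ w : E3, ‖w‖ ≤ 5 / 4 → (μ {w} ≠ 0 ↔ ν {w} ≠ 0)) →
      (∃ a : ℝ, 9 / 10 ≤ a ∧ a ≤ 1 ∧ ∃ T : Finset E3,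
        (↑T : Set E3) = {y : E3 | μ {y} ≠ 0 ∧ y ≠ 0 ∧ ‖y‖ ≤ 5 / 4 * a} ∧
        (ShellCloseTo (a / 20) T (Finset.image (fun v : E3 => a • v) fccKissingPattern) ∨
          ShellCloseTo (a / 20) T (Finset.image (fun v : E3 => a • v) hcpKissingPattern))) →
      (∃ a : ℝ, 9 / 10 ≤ a ∧ a ≤ 1 ∧ ∃ T : Finset E3,
        (↑T : Set E3) = {y : E3 | ν {y} ≠ 0 ∧ y ≠ 0 ∧ ‖y‖ ≤ 5 / 4 * a} ∧
        (ShellCloseTo (a / 20) T (Finset.image (fun v : E3 => a • v) fccKissingPattern) ∨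
          ShellCloseTo (a / 20) T (Finset.image (fun v : E3 => a • v) hcpKissingPattern))) from
    ⟨key h, key fun w hw => (h w hw).symm⟩
  intro μ ν h hμ
  obtain ⟨a, ha₁, ha₂, T, hT, hclose⟩ := hμ
  refine ⟨a, ha₁, ha₂, T, ?_, hclose⟩
  have hrad : ∀ w : E3, ‖w‖ ≤ 5 / 4 * a → ‖w‖ ≤ 5 / 4 := fun w hw => by nlinarith
  rw [hT]
  ext w
  simp only [Set.mem_setOf_eq]
  constructor
  · rintro ⟨hw, hw0, hle⟩
    exact ⟨(h w (hrad w hle)).1 hw, hw0, hle⟩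
  · rintro ⟨hw, hw0, hle⟩
    exact ⟨(h w (hrad w hle)).2 hw, hw0, hle⟩

/-- **An `(a/20)`-good shell is `(1/25)`-loosely good.**  The twelve `(a/20)`-matched atoms have norm `≤ a + a/20 <
(5/4 − 1/25)·a`, so the shrunken ball contains exactly the same atoms, and `a/20 ≤ a/100 + 1/25` because `a ≤ 1`. -/
theorem looseGoodShell_of_coarseGood {μ : Measure E3}
    (h : ∃ a : ℝ, 9 / 10 ≤ a ∧ a ≤ 1 ∧ ∃ T : Finset E3,
      (↑T : Set E3) = {y : E3 | μ {y} ≠ 0 ∧ y ≠ 0 ∧ ‖y‖ ≤ 5 / 4 * a} ∧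
      (ShellCloseTo (a / 20) T (Finset.image (fun v : E3 => a • v) fccKissingPattern) ∨
        ShellCloseTo (a / 20) T (Finset.image (fun v : E3 => a • v) hcpKissingPattern))) :
    LooseGoodShell (1 / 25) μ := by
  obtain ⟨a, ha₁, ha₂, T, hT, hclose⟩ := h
  have ha0 : 0 ≤ a := by linarith
  -- every atom of the shell set has norm `≤ a + a/20`
  have hnormT : ∀ w ∈ T, ‖w‖ ≤ a + a / 20 := by
    rcases hclose with hc | hc
    · exact norm_le_of_shellCloseTo ha0 (fun v hv => norm_eq_one_of_mem_fccKissingPattern hv) hc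
    · exact norm_le_of_shellCloseTo ha0 (fun v hv => norm_eq_one_of_mem_hcpKissingPattern hv) hc
  have hrad : a + a / 20 ≤ (5 / 4 - 1 / 25) * a := by nlinarith
  refine ⟨a, ha₁, ha₂, T, ?_, ?_⟩
  · ext w
    simp only [Set.mem_setOf_eq]
    constructor
    · intro hw
      have hw' : w ∈ (↑T : Set E3) := hw
      rw [hT] at hw'
      exact ⟨hw'.1, hw'.2.1, (hnormT w hw).trans hrad⟩
    · rintro ⟨hμ, hw0, hwn⟩
      have : w ∈ (↑T : Set E3) := by
        rw [hT]
        refine ⟨hμ, hw0, hwn.trans ?_⟩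
        nlinarith
      exact this
  · have hη : a / 20 ≤ a / 100 + 1 / 25 := by linarith
    rcases hclose with hc | hc
    · exact Or.inl (shellCloseTo_mono hη hc)
    · exact Or.inr (shellCloseTo_mono hη hc)

/-- **The coarse certificate is a coarse periodic crystallization theorem.**  The hardest stub `stub_coarsePricing`
of line `coarse-holonomy-liouville` (its local abbreviations unfolded): for every hard core `δ > 0` some `c > 0`
prices the `(a/20)`-bad root shell linearly over all point-stationary `δ`-hard-core probability laws.  It implies:
every periodic configuration of `ℝ³` with `1/3`-separated points and at least `t · #motif` motif sites whose shell is
not `(a/20)`-good has `e(Q) ≥ e* + c·t`, `c = c(1/3)`. -/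
theorem le_energyPerParticle_of_coarsePricing
    (hC : ∀ δ : ℝ, 0 < δ → ∃ c : ℝ, 0 < c ∧
      ∀ P : Measure (Measure E3), IsProbabilityMeasure P →
        (∀ᵐ μ ∂P, IsRootedHardCore δ μ) → IsPointStationaryLaw P →
        eStar + c * (P {μ | ¬ (∃ a : ℝ, 9 / 10 ≤ a ∧ a ≤ 1 ∧ ∃ T : Finset E3,
          (↑T : Set E3) = {y : E3 | μ {y} ≠ 0 ∧ y ≠ 0 ∧ ‖y‖ ≤ 5 / 4 * a} ∧
          (ShellCloseTo (a / 20) T (Finset.image (fun v : E3 => a • v) fccKissingPattern) ∨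
            ShellCloseTo (a / 20) T (Finset.image (fun v : E3 => a • v) hcpKissingPattern)))}).toReal ≤
        meanRootEnergy P) :
    ∃ c : ℝ, 0 < c ∧ ∀ Q : PeriodicConfiguration 3, IsSepThird Q → ∀ t : ℝ,
      t * (Q.motif.card : ℝ) ≤ (Nat.card {x : Q.motif // ¬ (∃ a : ℝ, 9 / 10 ≤ a ∧ a ≤ 1 ∧ ∃ T : Finset E3,
          (↑T : Set E3) = {y : E3 | (rerooted Q (x : E3)) {y} ≠ 0 ∧ y ≠ 0 ∧ ‖y‖ ≤ 5 / 4 * a} ∧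
          (ShellCloseTo (a / 20) T (Finset.image (fun v : E3 => a • v) fccKissingPattern) ∨
            ShellCloseTo (a / 20) T (Finset.image (fun v : E3 => a • v) hcpKissingPattern)))} : ℝ) →
      eStar + c * t ≤ Q.energyPerParticle lennardJones := by
  obtain ⟨c, hc, hprice⟩ := hC (1 / 3) (by norm_num)
  refine ⟨c, hc, fun Q hsep t hbad => ?_⟩
  exact le_energyPerParticle_of_pricing
    (G := fun μ : Measure E3 => ∃ a : ℝ, 9 / 10 ≤ a ∧ a ≤ 1 ∧ ∃ T : Finset E3,
      (↑T : Set E3) = {y : E3 | μ {y} ≠ 0 ∧ y ≠ 0 ∧ ‖y‖ ≤ 5 / 4 * a} ∧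
      (ShellCloseTo (a / 20) T (Finset.image (fun v : E3 => a • v) fccKissingPattern) ∨
        ShellCloseTo (a / 20) T (Finset.image (fun v : E3 => a • v) hcpKissingPattern)))
    (fun h => coarseGood_congr_of_local h) hc hprice Q hsep hbad

/-- **The coarse certificate contains `Residual.ShellGap (1/25)`.**  Since an `(a/20)`-good shell is `(1/25)`-loosely
good (`looseGoodShell_of_coarseGood`), the `(1/25)`-loosely-bad motif sites are among the coarse-bad ones, and the
coarse periodic crystallization theorem prices them: `stub_coarsePricing` (unfolded) implies `ShellGap (1/25)`, a
`θ`-loosening (`θ = 1/25 ≤ 1/10`) of the open residual `ShellGap 0` of line `equilibrium-in-law-surgery`. -/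
theorem shellGap_of_coarsePricing :
    (∀ δ : ℝ, 0 < δ → ∃ c : ℝ, 0 < c ∧
      ∀ P : Measure (Measure (EuclideanSpace ℝ (Fin 3))), IsProbabilityMeasure P →
        (∀ᵐ μ ∂P, IsRootedHardCore δ μ) → IsPointStationaryLaw P →
        eStar + c * (P {μ | ¬ (∃ a : ℝ, 9 / 10 ≤ a ∧ a ≤ 1 ∧ ∃ T : Finset (EuclideanSpace ℝ (Fin 3)),
          (↑T : Set (EuclideanSpace ℝ (Fin 3))) = {y : EuclideanSpace ℝ (Fin 3) | μ {y} ≠ 0 ∧ y ≠ 0 ∧ ‖y‖ ≤ 5 / 4 * a} ∧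
          (ShellCloseTo (a / 20) T (Finset.image (fun v : EuclideanSpace ℝ (Fin 3) => a • v) fccKissingPattern) ∨
            ShellCloseTo (a / 20) T (Finset.image (fun v : EuclideanSpace ℝ (Fin 3) => a • v) hcpKissingPattern)))}).toReal ≤
        meanRootEnergy P) →
    ShellGap (1 / 25) := by
  intro hC
  obtain ⟨c, hc, hgap⟩ := le_energyPerParticle_of_coarsePricing hC
  intro t ht
  refine ⟨c * t, mul_pos hc ht, fun Q hsep hbad => hgap Q hsep t (hbad.trans ?_)⟩
  -- loosely-bad sites are coarse-bad
  refine Nat.cast_le.2 ?_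
  unfold looseBadMotifCount
  rw [Nat.card_eq_fintype_card, Nat.card_eq_fintype_card]
  exact Fintype.card_subtype_mono _ _ fun x hx hgood => hx (looseGoodShell_of_coarseGood hgood)

end Summit.AtomisticToContinuum.Crystallization.Theorems.PalmUnimodularRigidityMinimiserShells.PricingContainment

end
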